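import Summits.AtomisticToContinuum.Crystallization.Theorems.ChargedEnergyGapHarmonicTransfer
import Literature.Geometry.MetricGeometry.PointedGromovHausdorff
import HarnessLib

/-!
# Charged energy gap — P-Z₁ «LABELLED COVERING»: a Barlow-labelled reference is `219/100`-relatively dense

Part P-Z₁ of node 63/64 of the `decomp-a2c` lens-3 line on `PricedLinkCensus.ChargedEnergyGap` (residual mode; designate pair
(H𝄪ˢ) `LocalSeamTransferBoundS` ∧ (N𝄪ˢ) `LocalSeamReductionS`; g64 attack target `FarResidueBound (3/5) (1/3) 3 160 80 (1/1350) (1/45) A_H`,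
critic row 1178 agenda (a)).  The charging proof of `FarResidueBound` needs LOWER bounds on the carrier masses (`shellMassL`, `transMassL`,
`pricedNearCountL` are sums over reference points of a region), hence a UNIFORM covering radius of the reference point set.  The
hypothesis that delivers it is the labelling `IsLabelledRef lam ℓ P` (every motif site carries a Barlow chart of reach `ℓ` at discrete
strain `lam`), not the separation.

* §1 `isometry_surjective` — an isometric self-map of `E3` is onto (translate to a fixed point, then
  `Isometry.surjective_of_properSpace`); `IsBarlowImage.exists_dist_le` — every point of space is within `81/100` of any Barlow IMAGE
  (the stacking's covering radius `√(a²/3 + h²/4)`, `exists_mem_barlowStacking_dist_sq_le`, at the window `a ≤ 11/10`, `h² ≤ 121/150·a²`: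
  `321·a²/600 ≤ 0.6474 ≤ (81/100)²`).
* §2 `LabelledWithin.exists_closer` — ONE PROPAGATION STEP: from a point `y` labelled within `ℓ ≥ 3` at strain `lam ≤ 1/3`, a target `w`
  with `219/100 < dist w y ≤ 219/100 + 19/50` is within `219/100` of a configuration point: aim the chart at the point `t = 219/100` along
  `w − y`, pick a label within `81/100` of it (so within `3 ≤ ℓ` of the chart centre, hence carried), and lose `lam·3 ≤ 1` to the strain:
  `(ρ − t) + 81/100 + 1 ≤ 219/100`.
* §3 ★ `IsLabelledRef.exists_dist_le` — every point of space is within `219/100` of the point set of a reference labelled within `ℓ ≥ 3`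
  at strain `lam ≤ 1/3` (induction over steps of `19/50` from one configuration point; motif sites suffice by lattice translation);
  record form `exists_point_near_record` at `(lam, ℓ) = (1/3, 3)`.

No field, energy or separation enters.  [geometry; folklore covering argument]
-/

noncomputable section

open scoped Classical
open Literature.MathematicalPhysics.StatisticalMechanics
open Literature.Geometry.DiscreteGeometry
open Summit.AtomisticToContinuum.Crystallization.Theses.PricedLinkCensus
open Summit.AtomisticToContinuum.Crystallization.Theorems.ChargedEnergyGapNegative

namespace Summit.AtomisticToContinuum.Crystallization.Theorems.ChargedEnergyGapChartDial

/-! ## §1 Isometries of space are onto; a Barlow image covers space at radius `81/100` -/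

/-- An isometric self-map of `E3` is surjective: `x ↦ g x − g 0` is an isometry fixing `0`, onto by `Isometry.surjective_of_properSpace`. -/
theorem isometry_surjective {g : E3 → E3} (hg : Isometry g) : Function.Surjective g := by
  have he : Isometry fun x => g x - g 0 :=
    Isometry.of_dist_eq fun x y => by rw [dist_sub_right, hg.dist_eq]
  have h0 : (fun x => g x - g 0) 0 = 0 := sub_self _
  intro q
  obtain ⟨p, hp⟩ := he.surjective_of_properSpace h0 (q - g 0)
  exact ⟨p, sub_left_injective hp⟩

/-- ★ Every point of space is within `81/100` of any Barlow image. -/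
theorem IsBarlowImage.exists_dist_le {S : Set E3} (hS : IsBarlowImage S) (q : E3) : ∃ x ∈ S, dist q x ≤ 81 / 100 := by
  obtain ⟨a, h, s, g, ha, hh, -, hg, rfl⟩ := hS
  obtain ⟨p, rfl⟩ := isometry_surjective hg q
  obtain ⟨z, hz, hd⟩ := exists_mem_barlowStacking_dist_sq_le (by linarith [ha.1] : a ≠ 0) hh.1 s p
  refine ⟨g z, Set.mem_image_of_mem g hz, ?_⟩
  rw [hg.dist_eq]
  have ha2 : a ^ 2 ≤ 121 / 100 := by nlinarith [ha.1, ha.2]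
  have hb : a ^ 2 / 3 + h ^ 2 / 4 ≤ (81 / 100) ^ 2 := by nlinarith [hh.2.2]
  exact (pow_le_pow_iff_left₀ dist_nonneg (by norm_num) two_ne_zero).1 (hd.trans hb)

/-! ## §2 One propagation step from a labelled point -/

/-- ★ **PROPAGATION STEP**: from a point `y` Barlow-labelled within `ℓ ≥ 3` at strain `lam ≤ 1/3`, every target at distance in
`(219/100, 219/100 + 19/50]` from `y` is within `219/100` of a configuration point. -/
theorem LabelledWithin.exists_closer {lam ℓ : ℝ} {Q : PeriodicConfiguration 3} {y w : E3} (h : LabelledWithin lam ℓ Q y)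
    (hlam : lam ≤ 1 / 3) (hℓ : 3 ≤ ℓ) (hw : dist w y ≤ 219 / 100 + 19 / 50) (hw' : 219 / 100 < dist w y) :
    ∃ z ∈ Q.points, dist w z ≤ 219 / 100 := by
  obtain ⟨S, hS, Φ, x₀, hx₀, hy, hlab, -, hstr⟩ := h
  have hρ0 : 0 < dist w y := by linarith
  set t : ℝ := 219 / 100 with ht
  set v : E3 := (t / dist w y) • (w - y) with hv
  have htρ : 0 ≤ t / dist w y := by positivity
  have hnv : ‖v‖ = t := by
    rw [hv, norm_smul, Real.norm_of_nonneg htρ, ← dist_eq_norm, div_mul_cancel₀ _ hρ0.ne']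
  obtain ⟨x, hx, hdx⟩ := hS.exists_dist_le (x₀ + v)
  have hxv : ‖(x - x₀) - v‖ ≤ 81 / 100 := by
    rw [sub_sub, ← dist_eq_norm, dist_comm]; exact hdx
  have hxn : ‖x - x₀‖ ≤ 81 / 100 + t := by
    have h1 : x - x₀ = ((x - x₀) - v) + v := by abel
    rw [h1]
    exact (norm_add_le _ _).trans (by rw [hnv]; linarith)
  have hxx₀ : dist x x₀ ≤ ℓ := by rw [dist_eq_norm]; linarith
  have hx₀₀ : dist x₀ x₀ ≤ ℓ := by rw [dist_self]; linarith
  have hz : Φ x ∈ Q.points := hlab x hx hxx₀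
  have hs := hstr x hx x₀ hx₀ hxx₀ hx₀₀
  rw [hy] at hs
  have h3 : ‖(Φ x - y) - (x - x₀)‖ ≤ 1 / 3 * (81 / 100 + t) := by
    refine hs.trans ?_
    nlinarith [norm_nonneg (x - x₀)]
  have h1 : ‖(w - y) - v‖ = dist w y - t := by
    have h1' : (w - y) - v = (1 - t / dist w y) • (w - y) := by rw [hv, sub_smul, one_smul]
    have hc : 0 ≤ 1 - t / dist w y := by
      rw [sub_nonneg, div_le_one hρ0]; exact hw'.le
    rw [h1', norm_smul, Real.norm_of_nonneg hc, ← dist_eq_norm, sub_mul, one_mul, div_mul_cancel₀ _ hρ0.ne']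
  refine ⟨Φ x, hz, ?_⟩
  calc dist w (Φ x) = ‖((w - y) - v) + (-(((x - x₀) - v)) - ((Φ x - y) - (x - x₀)))‖ := by
        rw [dist_eq_norm]; congr 1; abel
    _ ≤ ‖(w - y) - v‖ + (‖(x - x₀) - v‖ + ‖(Φ x - y) - (x - x₀)‖) := by
        refine (norm_add_le _ _).trans (add_le_add le_rfl ?_)
        exact (norm_sub_le _ _).trans (by rw [norm_neg])
    _ ≤ (dist w y - t) + (81 / 100 + 1 / 3 * (81 / 100 + t)) := by rw [h1]; linarith
    _ ≤ 219 / 100 := by rw [ht]; linarith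

/-! ## §3 ★ The labelled covering radius -/

/-- ★ **LABELLED COVERING**: every point of space is within `219/100` of the point set of a reference Barlow-labelled within `ℓ ≥ 3` at
strain `lam ≤ 1/3` around every motif site. -/
theorem IsLabelledRef.exists_dist_le {lam ℓ : ℝ} {P : PeriodicConfiguration 3} (hL : IsLabelledRef lam ℓ P) (hlam : lam ≤ 1 / 3)
    (hℓ : 3 ≤ ℓ) (w : E3) : ∃ y ∈ P.points, dist w y ≤ 219 / 100 := by
  -- the step at an arbitrary configuration point, by translation to the motif
  have step : ∀ y ∈ P.points, ∀ w : E3, dist w y ≤ 219 / 100 + 19 / 50 → ∃ z ∈ P.points, dist w z ≤ 219 / 100 := by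
    intro y hy w hw
    by_cases hw' : dist w y ≤ 219 / 100
    · exact ⟨y, hy, hw'⟩
    obtain ⟨m, hm, g, hg, rfl⟩ := hy
    have hmw : dist (w - g) m = dist w (m + g) := by
      rw [← dist_add_right (w - g) m g, sub_add_cancel]
    obtain ⟨z, hz, hdz⟩ := (hL m hm).exists_closer (w := w - g) hlam hℓ (by rw [hmw]; exact hw)
      (by rw [hmw]; exact lt_of_not_ge hw')
    refine ⟨z + g, P.add_mem_points hz hg, ?_⟩
    rwa [← dist_add_right (w - g) z g, sub_add_cancel] at hdz
  obtain ⟨y₀, hy₀⟩ := P.points_nonempty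
  -- induction over steps of `19/50` from `y₀`
  have main : ∀ n : ℕ, ∀ w : E3, dist w y₀ ≤ n * (19 / 50) → ∃ y ∈ P.points, dist w y ≤ 219 / 100 := by
    intro n
    induction n with
    | zero =>
      intro w hw
      exact ⟨y₀, hy₀, by simp only [Nat.cast_zero, zero_mul] at hw; linarith⟩
    | succ n ih =>
      intro w hw
      by_cases hle : dist w y₀ ≤ n * (19 / 50)
      · exact ih w hle
      push Not at hle
      have hd0 : 0 < dist w y₀ := lt_of_le_of_lt (by positivity) hle
      set c : ℝ := (n : ℝ) * (19 / 50) / dist w y₀ with hc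
      have hc0 : 0 ≤ c := by positivity
      have hc1 : c ≤ 1 := by rw [hc, div_le_one hd0]; exact hle.le
      set w' : E3 := y₀ + c • (w - y₀) with hw'
      have hw'₀ : dist w' y₀ ≤ n * (19 / 50) := by
        rw [dist_eq_norm, hw', add_sub_cancel_left, norm_smul, Real.norm_of_nonneg hc0, ← dist_eq_norm, hc,
          div_mul_cancel₀ _ hd0.ne']
      obtain ⟨y', hy', hdy'⟩ := ih w' hw'₀
      have hww' : dist w w' ≤ 19 / 50 := by
        have h1 : w - w' = (1 - c) • (w - y₀) := by rw [hw', sub_smul, one_smul]; abel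
        rw [dist_eq_norm, h1, norm_smul, Real.norm_of_nonneg (by linarith), ← dist_eq_norm, sub_mul, one_mul, hc,
          div_mul_cancel₀ _ hd0.ne']
        push_cast at hw
        linarith
      refine step y' hy' w ?_
      calc dist w y' ≤ dist w w' + dist w' y' := dist_triangle _ _ _
        _ ≤ 19 / 50 + 219 / 100 := add_le_add hww' hdy'
        _ = 219 / 100 + 19 / 50 := by ring
  obtain ⟨n, hn⟩ := exists_nat_ge (dist w y₀ / (19 / 50))
  exact main n w (by rwa [div_le_iff₀ (by norm_num : (0 : ℝ) < 19 / 50)] at hn)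

/-- Record form at `(lam, ℓ) = (1/3, 3)`: a `(1/3, 3)`-labelled reference is `219/100`-relatively dense. -/
theorem exists_point_near_record {P : PeriodicConfiguration 3} (hL : IsLabelledRef (1 / 3) 3 P) (w : E3) :
    ∃ y ∈ P.points, dist w y ≤ 219 / 100 :=
  hL.exists_dist_le le_rfl le_rfl w

/-- ★ Closed-ball form: every closed ball of radius `≥ 219/100` meets the point set of a labelled reference — the carrier-mass lower
bounds of the charging argument start here. -/
theorem IsLabelledRef.exists_mem_closedBall {lam ℓ : ℝ} {P : PeriodicConfiguration 3} (hL : IsLabelledRef lam ℓ P)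
    (hlam : lam ≤ 1 / 3) (hℓ : 3 ≤ ℓ) {r : ℝ} (hr : 219 / 100 ≤ r) (w : E3) :
    ∃ y ∈ P.points, y ∈ Metric.closedBall w r := by
  obtain ⟨y, hy, hd⟩ := hL.exists_dist_le hlam hℓ w
  exact ⟨y, hy, Metric.mem_closedBall.2 (by rw [dist_comm]; linarith)⟩

end Summit.AtomisticToContinuum.Crystallization.Theorems.ChargedEnergyGapChartDial
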